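import Mathlib

/-!
# `SeaFactorisationBridge` (crux stmt-QuantumFields-13880) — negative-side support: marginal dilution of
# sign defects does not license sign transfer (finite models)

Standing-disprover extraction (cdisprove cycle 1).  Definition-free finite models (abstract cells) for
step (3) of the crux's informal mechanism, "the SIGNED functional inherits every connected correlator
from the phase-quenched one by a Kotecký–Preiss expansion in the window-dilute negative cells of
`CoerciveSea` (ii)".  `CoerciveSea` (ii) / `NegativeCellsDilute` (a) bound ONE-CELL MARGINALS of the
sign-defect field only.

* `dilute_marginals_zero_sign` — for every `n ≥ 1` a law on defect patterns with one-cell marginals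
  `1/(2n)` (as dilute as desired) and sign average EXACTLY `0`: the signed partition function
  `⟨sign⟩₊ Z₊` vanishes, signed expectations are junk — marginal dilution alone transfers nothing; a
  decorrelation input on the defect field under the phase-quenched measure is load-bearing, and neither
  hypothesis of the bridge states one (`RobustYangMills` clusters only measures `e^{−β′S_W−W}` with `W`
  sup-small, which the sea is not — sibling file `SupSmallCone.lean`).
* `half_defect_mass_zero_sign` — same witness, total defect probability `½` made explicit: tightness
  of any "signed ≥ (1−2p)·quenched for conditional defect mass p < ½" lemma (card
  condition-then-quench, B2) — marginal dilution of the cells inside a block cannot feed it.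
* `independent_defects_sign_average` — with independent defects of probability `δ` per cell the sign
  average is `(1−2δ)ⁿ`: exponentially small in the number of window cells, so sign transfer can only be
  an EXTENSIVE (cluster-expansion) statement about `log⟨sign⟩₊`, uniform in the volume, never a lower
  bound on `⟨sign⟩₊`.
-/

namespace Summit.QuantumFields.QCD.Theorems.SeaFactorisationBridge.Negative

open Finset

/-- **Dilute marginals, zero sign average** (finite model): `p(no defect) = ½`,
`p(single defect at i) = 1/(2n)`; every one-cell marginal is `1/(2n)`, the mean sign — pattern sign
`Option.elim c 1 (fun _ => −1)`: `+1` for the clean pattern `none`, `−1` for a single defect — is `0`.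
[folklore] -/
theorem dilute_marginals_zero_sign (n : ℕ) (hn : 0 < n) :
    ∃ p : Option (Fin n) → ℝ, (∀ c, 0 ≤ p c) ∧ ∑ c, p c = 1 ∧
      (∀ i : Fin n, ∑ c, (if c = some i then p c else 0) = 1 / (2 * n)) ∧
      ∑ c, p c * Option.elim c 1 (fun _ => (-1 : ℝ)) = 0 := by
  have hn' : (n : ℝ) ≠ 0 := by exact_mod_cast hn.ne'
  refine ⟨fun c => Option.elim c (1 / 2) fun _ => 1 / (2 * n), ?_, ?_, ?_, ?_⟩
  · intro c; cases c <;> simp only [Option.elim] <;> positivity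
  · rw [Fintype.sum_option]
    simp only [Option.elim, sum_const, card_univ, Fintype.card_fin, nsmul_eq_mul]
    field_simp; ring
  · intro i
    rw [Finset.sum_ite_eq' univ (some i)]
    simp
  · rw [Fintype.sum_option]
    simp only [Option.elim, sum_const, card_univ, Fintype.card_fin, nsmul_eq_mul]
    field_simp; ring

/-- **Half defect mass, zero sign** (finite model; tightness of "signed block mass `≥ (1−2p)·`quenched
block mass when the conditional defect mass is `≤ p < ½`"): with one-cell marginals `1/(2n)` the total
defect probability is exactly `½` and the mean sign is `0`. [folklore] -/
theorem half_defect_mass_zero_sign (n : ℕ) (hn : 0 < n) :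
    ∃ p : Option (Fin n) → ℝ, (∀ c, 0 ≤ p c) ∧ ∑ c, p c = 1 ∧
      (∀ i : Fin n, p (some i) = 1 / (2 * n)) ∧ ∑ i : Fin n, p (some i) = 1 / 2 ∧
      ∑ c, p c * Option.elim c 1 (fun _ => (-1 : ℝ)) = 0 := by
  have hn' : (n : ℝ) ≠ 0 := by exact_mod_cast hn.ne'
  refine ⟨fun c => Option.elim c (1 / 2) fun _ => 1 / (2 * n), ?_, ?_, fun i => rfl, ?_, ?_⟩
  · intro c; cases c <;> simp only [Option.elim] <;> positivity
  · rw [Fintype.sum_option]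
    simp only [Option.elim, sum_const, card_univ, Fintype.card_fin, nsmul_eq_mul]
    field_simp; ring
  · simp only [Option.elim, sum_const, card_univ, Fintype.card_fin, nsmul_eq_mul]
    field_simp
  · rw [Fintype.sum_option]
    simp only [Option.elim, sum_const, card_univ, Fintype.card_fin, nsmul_eq_mul]
    field_simp; ring

/-- **Independent dilute defects** (finite model): under the product law with defect probability `δ`
per cell, `E[∏ᵢ (−1)^{defectᵢ}] = (1 − 2δ)ⁿ`. [folklore] -/
theorem independent_defects_sign_average (n : ℕ) (δ : ℝ) :
    ∑ x : Fin n → Bool, ∏ i, ((if x i then δ else 1 - δ) * (if x i then (-1 : ℝ) else 1)) =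
      (1 - 2 * δ) ^ n := by
  classical
  have key := Finset.prod_univ_sum (fun _ : Fin n => (univ : Finset Bool))
    (fun _ b => (if b then δ else 1 - δ) * (if b then (-1 : ℝ) else 1))
  rw [Fintype.piFinset_univ] at key
  rw [← key]
  simp
  ring

end Summit.QuantumFields.QCD.Theorems.SeaFactorisationBridge.Negative
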